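import Summits.ResolutionOfSingularities.ResolutionOfSingularities.Theorems.EquisingularLiftEquisingularLiftNatTowerAssemblyV7
import Summits.ResolutionOfSingularities.ResolutionOfSingularities.Theorems.EquisingularLiftEquisingularLiftNatReachFourPointResolutionOfSubchainLift
import Summits.ResolutionOfSingularities.ResolutionOfSingularities.Theorems.EquisingularLiftEquisingularLiftNatRationalCarrierLiftDischarge
import Summits.ResolutionOfSingularities.ResolutionOfSingularities.Theorems.EquisingularLiftEquisingularLiftNatTCPlusInvBaseKCL
import HarnessLib

/-!
# Route `EquisingularLift`, crux EL♮(3) (stmt-ResolutionOfSingularities-20148) — rung TOWER₄ AT `n = 3`, CLOSED MODULO {F-102, S6@`Inv₃`} (S7′ DISCHARGED),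
# with the S6 socket closed over the FULL GLOBAL CONTEXT (supersedes `…three_of_cech` p577745, whose socket quantified `(P, q, Y, Ch)` bare):
# `stub_elnat_coneTowerPointResolution_three_of_cechCtx`

res-D-pv-018 g5 (D hand of W4.5b; twin of this seat's nose closer `stub_elnat_ratNoseTowerResolution_three_of_cech` p575742). OURS; NOT a statement of
any manuscript; AI-written, weaker than expert review. No `sorry`; standard axioms; DEF-FREE; `--supports stmt-ResolutionOfSingularities-20148 --as helper`.

WHAT. The registered text of `stub_elnat_coneTowerPointResolution` @ `ReachTower₄` (res-L1-w45b-lead-2 `TARGET-CONETOWER4.sig.txt` sha16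
070981bcd9f54dfd) SPECIALISED TO `n = 3` (binder `(n : ℕ)` dropped, `n ↦ 3` — pure substitution by script), proved from exactly two hypotheses:
* F-102 `Literature.AlgebraicGeometry.Resolution.GenusZeroOverCompleteDVR` — the named published fact behind residue (T-j) (res-L1-type-o6
  `rationalCarrierLift_of_genusZeroOverCompleteDVR`, …NatRationalCarrierLiftDischarge p572358, gives `hTj : RationalCarrierLift O k θ P q` at every `(O, θ)`);
* S6 `hS6` — the Čech-witnessed round at `Tower.Inv₃`, i.e. the `hCech` binder of the v7 assembly `hsub_reachTower_four_of_kcl` (…NatTowerAssemblyV7 p576510)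
  closed over the GLOBAL CONTEXT `(k, O, θ, hθ, P, q, Y, Ch, hChStep, hChSplit, hYsp, hYirr, hYcl, hPint, hPnoeth, hPreg, hqprop, hqsm)` + `RationalCarrierLift O k θ P q`
  (the hypotheses an S6 closer actually reads — e.g. res-L1-w45b-stub-4's `Tower.hCech₃_of_lift_sec` p576661 / its frames variant; residual (L)/(N3)/(N3′));
  HONESTY: the earlier socket of p577745 asked for the `hCech` text at ARBITRARY `(P, q, Y, Ch)` — not what any S6 closer proves — so THIS is the pluggable closer;
while v7's third stand-in S7′ `hBaseKCL` (B9 at the `ConeForm` seed with the LOCALIZED shadow trace (vii-loc)) is DISCHARGED here by res-type-100's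
`inv_baseKCL` (…NatTCPlusInvBaseKCL p576847; it wants `[Fact p.Prime] [CharP k p]`, available exactly at this closer level, and `n = 3` via `hdim`).
PROOF = lead-2's INST `stub_elnat_coneTowerPointResolution_of_subchainLift₄` (…NatReachFourPointResolutionOfSubchainLift p569465) at `n = 3` fed with the
supplier `fun O … hCh₁ => hsub_reachTower_four_of_kcl k O … hCh₁ (hTj := F-102 discharge) (hS6 k O θ P q Y Ch) (fun W _ hnot _ hcone => inv_baseKCL p k O …)`.
So the TOWER₄ rung at `n = 3` is ONE tree theorem modulo one named fact and ONE named stand-in (S6), in the (R1) currency `InvKCL`/`Inv₃` — the same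
board as the nose rung p575742.
-/

set_option linter.dupNamespace false -- mandated namespace `Summit.<Summit>.<Problem>` of this single-conjunct summit
set_option linter.overlappingInstances false -- signatures carry `[IsDomain O] [IsDiscreteValuationRing O]`

noncomputable section

open CategoryTheory CategoryTheory.Limits AlgebraicGeometry TopologicalSpace Topology IsLocalRing
open Literature.AlgebraicGeometry.Resolution
open AlgebraicGeometry.Scheme.IdealSheafData
open Summit.ResolutionOfSingularities.ResolutionOfSingularities.Theses.EquisingularLift.Split
open Summit.ResolutionOfSingularities.ResolutionOfSingularities.Cruxes.EquisingularLift.StrataSplit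

namespace Summit.ResolutionOfSingularities.ResolutionOfSingularities.Cruxes.EquisingularLiftNat.Sections

/-- **TOWER₄ at `n = 3`, closed modulo {F-102, S6@`Inv₃`}** (see the module docstring): TARGET-CONETOWER4 specialised to `n = 3`, from the named fact
`GenusZeroOverCompleteDVR` and the S6 stand-in of v7 closed over the global context; S7′ discharged by `inv_baseKCL`. [folklore; pure composition of p569465 ∘ p576510 ∘
p572358 ∘ p576847] [OURS · L1 W4.5b] -/
theorem stub_elnat_coneTowerPointResolution_three_of_cechCtx (p : ℕ)
    (hF102 : Literature.AlgebraicGeometry.Resolution.GenusZeroOverCompleteDVR.{0})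
    (hS6 : ∀ (k : Type) [Field k] [IsAlgClosed k]
      (O : Type) [CommRing O] [IsDomain O] [IsDiscreteValuationRing O] [IsAdicComplete (IsLocalRing.maximalIdeal O) O]
      [IsAlgClosed (IsLocalRing.ResidueField O)] (θ : O →+* k) (hθ : Function.Surjective θ)
      (P : Scheme.{0}) (q : P ⟶ Spec (.of O)) (Y : Set P) (Ch : ∀ X' : Scheme.{0}, (X' ⟶ P) → Set X' → Prop)
      (hChStep : ∀ (X' X'' : Scheme.{0}) (σ' : X' ⟶ P) (S' : Set X') (C : X'.IdealSheafData) (τ : X'' ⟶ X'),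
        Ch X' σ' S' → IsBlowup τ C → Scheme.IsRegular C.subscheme → Flat (C.subschemeι ≫ σ' ≫ q) →
        σ' '' (C.support : Set X') ⊆ {y | ¬ IsGenericPoint y Y} → (C.support : Set X') ∩ (σ' ≫ q) ⁻¹' {IsLocalRing.closedPoint O} ⊆ S' →
        Ch X'' (τ ≫ σ') (closure (τ ⁻¹' (S' \ (C.support : Set X')))))
      (hChSplit : ∀ (X' : Scheme.{0}) (σ' : X' ⟶ P) (S' : Set X'), Ch X' σ' S' → Chain P Y X' σ' S')
      (hYsp : Y ⊆ q ⁻¹' {IsLocalRing.closedPoint O}) (hYirr : IsIrreducible Y) (hYcl : IsClosed Y) (hPint : IsIntegral P)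
      (hPnoeth : IsLocallyNoetherian P) (hPreg : Scheme.IsRegular P) (hqprop : IsProper q) (hqsm : SmoothOfRelativeDimension 3 q),
      RationalCarrierLift O k θ P q →
      ∀ {F₉ : Scheme.{0}} (Z₉ : Set F₉) (hZ₉ : IsClosed Z₉) {F₁₀ : Scheme.{0}} (υ' : F₁₀ ⟶ F₉)
          (G G' : Scheme.{0}) (γ : G ⟶ F₁₀) (T E K : Set G) (hE : IsClosed E) (Z : Set G) (hZ : IsClosed Z) (υ₂ : G' ⟶ G) (K' : Set G'),
          (Tower.Inv₃ O k θ P q Y Ch (DirLift.Ruled O k θ P q Y) F₉ Z₉ hZ₉ F₁₀ υ' G γ T E K ∧ IsClosed K ∧ K ⊆ closure (K \ E) ∧ K ≠ Set.univ) →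
          Z ⊆ E ∩ T → Z.Nonempty → TowerFull F₉ F₁₀ υ' Z₉ hZ₉ G γ Z hZ →
          (DirStepSec F₉ F₁₀ υ' Z₉ hZ₉ G γ Z hZ ∧ RationalCarrier (redSub F₉ Z₉ hZ₉) ∧
            (∀ x : redSub G Z hZ, IsRegularLocalRing (G.presheaf.stalk (redSubι G Z hZ x))) ∧
            (∀ (i : redSub G Z hZ ⟶ redSub G E hE), i ≫ redSubι G E hE = redSubι G Z hZ →
              ∀ x : redSub G Z hZ, IsRegularLocalRing ((redSub G E hE).presheaf.stalk (i x))) ∧ DirStepUnobs G E hE Z hZ) →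
          -- input (c) AT THIS ROUND, handed to the S6 closer (v7: DERIVED at the call site from the carrier datum of `INV₁` through the section iso —
          -- replaces the refutable closer-level `hFrameAll` of p575157): quasi-regular 2-frames of every regular `O`-flat centre with trace `𝓘⟨Z⟩`
          (∀ (X : Scheme.{0}) (σ : X ⟶ P) (S : Set X) (jG : G ⟶ X) (tG : G ⟶ Spec (.of k)) (𝒞 : X.IdealSheafData),
            Ch X σ S → IsIntegral X → IsLocallyNoetherian X → Scheme.IsRegular X → IsDominant (σ ≫ q) →
            IsPullback jG tG (σ ≫ q) (Spec.map (CommRingCat.ofHom θ)) → jG '' T = S →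
            𝒞.comap jG = vanishingIdeal ⟨Z, hZ⟩ → Flat (𝒞.subschemeι ≫ σ ≫ q) → Scheme.IsRegular 𝒞.subscheme →
            ∀ x ∈ 𝒞.support, ∃ c : Fin 2 → X.presheaf.stalk x, Ideal.span (Set.range c) = stalkIdeal 𝒞 x ∧ IsQuasiRegular c) →
          IsBlowup υ₂ (vanishingIdeal (⟨Z, hZ⟩ : Closeds G)) →
          (K' = ∅ ∨ ((ConeWitness G E hE K Z hZ ∨ closure (Z \ closure K) = Z) ∧ K' = closure (υ₂ ⁻¹' (K \ Z)))) →
          (Tower.Inv₃ O k θ P q Y Ch (DirLift.Ruled O k θ P q Y) F₉ Z₉ hZ₉ F₁₀ υ' G' (υ₂ ≫ γ) (closure (υ₂ ⁻¹' (T \ Z))) (υ₂ ⁻¹' Z) K' ∧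
              IsClosed K' ∧ K' ⊆ closure (K' \ υ₂ ⁻¹' Z) ∧ K' ≠ Set.univ) ∧
            (Tower.Inv₃ O k θ P q Y Ch (DirLift.Ruled O k θ P q Y) F₉ Z₉ hZ₉ F₁₀ υ' G' (υ₂ ≫ γ) (closure (υ₂ ⁻¹' (T \ Z))) (closure (υ₂ ⁻¹' (E \ Z))) K' ∧
              IsClosed K' ∧ K' ⊆ closure (K' \ closure (υ₂ ⁻¹' (E \ Z))) ∧ K' ≠ Set.univ)) :
    p.Prime → ∀ (k : Type) [Field k] [CharP k p] [IsAlgClosed k] (H : AlgebraicGeometry.Scheme.{0}) (ι : H ⟶ (Literature.AlgebraicGeometry.Motives.projectiveSpace 3 k).left), AlgebraicGeometry.IsClosedImmersion ι → AlgebraicGeometry.IsIntegral H → (∀ y : (Literature.AlgebraicGeometry.Motives.projectiveSpace 3 k).left, ∃ U : (Literature.AlgebraicGeometry.Motives.projectiveSpace 3 k).left.affineOpens, y ∈ (U : (Literature.AlgebraicGeometry.Motives.projectiveSpace 3 k).left.Opens) ∧ (ι.ker.ideal U).IsPrincipal) → (∃ (F' : AlgebraicGeometry.Scheme.{0}) (ρ'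 : F' ⟶ (Literature.AlgebraicGeometry.Motives.projectiveSpace 3 k).left) (T' : Set F'), (∀ Q : (∀ F₁ : AlgebraicGeometry.Scheme.{0}, (F₁ ⟶ (Literature.AlgebraicGeometry.Motives.projectiveSpace 3 k).left) → Set F₁ → Prop), Q (Literature.AlgebraicGeometry.Motives.projectiveSpace 3 k).left (CategoryTheory.CategoryStruct.id (Literature.AlgebraicGeometry.Motives.projectiveSpace 3 k).left) (Set.range ι) → (∀ (F₁ F₂ : AlgebraicGeometry.Scheme.{0}) (ρ : F₁ ⟶ (Literature.AlgebraicGeometry.Motives.projectiveSpace 3 k).left) (T₁ : Set F₁) (x : ↥(AlgebraicGeometry.Scheme.IdealSheafData.vanishingIdeal (⟨closure T₁, isClosed_closure⟩ : TopologicalSpace.Closeds F₁)).subscheme) (υ : F₂ ⟶ F₁) (hx : IsClosed ({((AlgebraicGeometry.Scheme.IdealSheafData.vanishingIdeal (⟨closure T₁, isClosed_closure⟩ : TopologicalSpace.Closeds F₁)).subschemeι x : F₁)} : Set F₁)), Q F₁ ρ T₁ → ¬ IsRegularLocalRing ((AlgebraicGeometry.Scheme.IdealSheafData.vanishingIdeal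 (⟨closure T₁, isClosed_closure⟩ : TopologicalSpace.Closeds F₁)).subscheme.presheaf.stalk x) → IsRegularLocalRing (F₁.presheaf.stalk ((AlgebraicGeometry.Scheme.IdealSheafData.vanishingIdeal (⟨closure T₁, isClosed_closure⟩ : TopologicalSpace.Closeds F₁)).subschemeι x)) → Literature.AlgebraicGeometry.Resolution.IsBlowup υ (AlgebraicGeometry.Scheme.IdealSheafData.vanishingIdeal (⟨{((AlgebraicGeometry.Scheme.IdealSheafData.vanishingIdeal (⟨closure T₁, isClosed_closure⟩ : TopologicalSpace.Closeds F₁)).subschemeι x : F₁)}, hx⟩ : TopologicalSpace.Closeds F₁)) → Q F₂ (CategoryTheory.CategoryStruct.comp υ ρ) (closure (υ ⁻¹' (T₁ \ {((AlgebraicGeometry.Scheme.IdealSheafData.vanishingIdeal (⟨closure T₁, isClosed_closure⟩ : TopologicalSpace.Closeds F₁)).subschemeι x : F₁)}))) ∧ (∀ (F₉ : AlgebraicGeometry.Scheme.{0}) (β : F₉ ⟶ F₂) (T₉ : Set F₉), ReachTower₄ F₁ F₂ υ ((AlgebraicGeometry.Scheme.IdealSheafData.vanishingIdeal (⟨closure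 T₁, isClosed_closure⟩ : TopologicalSpace.Closeds F₁)).subschemeι x) (closure (υ ⁻¹' (T₁ \ {((AlgebraicGeometry.Scheme.IdealSheafData.vanishingIdeal (⟨closure T₁, isClosed_closure⟩ : TopologicalSpace.Closeds F₁)).subschemeι x : F₁)}))) F₉ β T₉ → Q F₉ (CategoryTheory.CategoryStruct.comp (CategoryTheory.CategoryStruct.comp β υ) ρ) T₉)) → Q F' ρ' T') ∧ Literature.AlgebraicGeometry.Resolution.Scheme.IsRegular (AlgebraicGeometry.Scheme.IdealSheafData.vanishingIdeal (⟨closure T', isClosed_closure⟩ : TopologicalSpace.Closeds F')).subscheme) → ∃ (O : Type) (_ : CommRing O) (_ : IsDomain O) (_ : IsDiscreteValuationRing O) (_ : CharZero O) (π : O →+* k), Function.Surjective π ∧ (letI := MvPolynomial.gradedAlgebra (σ := Fin (3 + 1)) (R := O); letI := MvPolynomial.gradedAlgebra (σ := Fin (3 + 1)) (R := k); ∀ (φ : MvPolynomial.homogeneousSubmodule (Fin (3 + 1)) O →+*ᵍ MvPolynomial.homogeneousSubmodule (Fin (3 + 1)) k) (hφ' : HomogeneousIdeal.irrelevant (MvPolynomial.homogeneousSubmodule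 (Fin (3 + 1)) k) ≤ (HomogeneousIdeal.irrelevant (MvPolynomial.homogeneousSubmodule (Fin (3 + 1)) O)).map φ), (∀ s, φ s = MvPolynomial.map π s) → ∀ Y : Set (AlgebraicGeometry.Proj (MvPolynomial.homogeneousSubmodule (Fin (3 + 1)) O)), Y = Set.range (CategoryTheory.CategoryStruct.comp ι (AlgebraicGeometry.Proj.map φ hφ') : H ⟶ (AlgebraicGeometry.Proj (MvPolynomial.homogeneousSubmodule (Fin (3 + 1)) O))) → ∃ (P' : AlgebraicGeometry.Scheme.{0}) (σ : P' ⟶ (AlgebraicGeometry.Proj (MvPolynomial.homogeneousSubmodule (Fin (3 + 1)) O))) (S' : Set P'), (∀ Q : (∀ X' : AlgebraicGeometry.Scheme.{0}, (X' ⟶ (AlgebraicGeometry.Proj (MvPolynomial.homogeneousSubmodule (Fin (3 + 1)) O))) → Set X' → Prop), Q (AlgebraicGeometry.Proj (MvPolynomial.homogeneousSubmodule (Fin (3 + 1)) O)) (CategoryTheory.CategoryStruct.id (AlgebraicGeometry.Proj (MvPolynomial.homogeneousSubmodule (Fin (3 + 1)) O))) Y → (∀ (X' X'' : AlgebraicGeometry.Scheme.{0})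 (σ' : X' ⟶ (AlgebraicGeometry.Proj (MvPolynomial.homogeneousSubmodule (Fin (3 + 1)) O))) (Y' : Set X') (C : X'.IdealSheafData) (τ : X'' ⟶ X'), Q X' σ' Y' → Literature.AlgebraicGeometry.Resolution.IsBlowup τ C → Literature.AlgebraicGeometry.Resolution.Scheme.IsRegular C.subscheme → AlgebraicGeometry.Flat (CategoryTheory.CategoryStruct.comp C.subschemeι (CategoryTheory.CategoryStruct.comp σ' (CategoryTheory.CategoryStruct.comp (AlgebraicGeometry.Proj.toSpecZero (MvPolynomial.homogeneousSubmodule (Fin (3 + 1)) O)) (AlgebraicGeometry.Spec.map (CommRingCat.ofHom (algebraMap O (MvPolynomial.homogeneousSubmodule (Fin (3 + 1)) O 0))))))) → σ' '' (C.support : Set X') ⊆ {x | ¬ IsGenericPoint x Y} → (C.support : Set X') ∩ (CategoryTheory.CategoryStruct.comp σ' (CategoryTheory.CategoryStruct.comp (AlgebraicGeometry.Proj.toSpecZero (MvPolynomial.homogeneousSubmodule (Fin (3 + 1)) O)) (AlgebraicGeometry.Spec.map (CommRingCat.ofHom (algebraMap O (MvPolynomial.homogeneousSubmodule (Fin (3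 + 1)) O 0)))))) ⁻¹' {IsLocalRing.closedPoint O} ⊆ Y' → Q X'' (CategoryTheory.CategoryStruct.comp τ σ') (closure (τ ⁻¹' (Y' \ (C.support : Set X'))))) → Q P' σ S') ∧ Literature.AlgebraicGeometry.Resolution.Scheme.IsRegular (AlgebraicGeometry.Scheme.IdealSheafData.vanishingIdeal (⟨closure S', isClosed_closure⟩ : TopologicalSpace.Closeds P')).subscheme) := by
  intro hp k _ _ _ H ι hι hH hloc hres
  exact stub_elnat_coneTowerPointResolution_of_subchainLift₄ p hp k 3 H ι hι hH hloc
    (fun O _ _ _ _ _ θ hθ P q Y Ch hChStep hChSplit hYsp hYirr hYcl hPint hPnoeth hPreg hqprop hqsm X' σ' S' hCh' hX'int hX'noeth hX'reg hX'dom F₁ hF₁ j t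
        hsq T₁ hT₁cl hT₁irr hjT₁ x hx U hU s hs hsU hsx hdim hxreg hsoff X₁ τ₁ hτ₁ hX₁int hX₁noeth hX₁reg hX₁dom F₂ hF₂ υ hυ j₂ t₂ hsq₂ hcomm hcarrier
        hirr₂ hCh₁ =>
      hsub_reachTower_four_of_kcl k O θ hθ P q Y Ch hChStep hChSplit hYsp hYirr hYcl hPint hPnoeth hPreg hqprop hqsm X' σ' S' hCh' hX'int hX'noeth
        hX'reg hX'dom F₁ hF₁ j t hsq T₁ hT₁cl hT₁irr hjT₁ x hx U hU s hs hsU hsx hdim hxreg hsoff X₁ τ₁ hτ₁ hX₁int hX₁noeth hX₁reg hX₁dom F₂ hF₂ υ hυ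
        j₂ t₂ hsq₂ hcomm hcarrier hirr₂ hCh₁ (rationalCarrierLift_of_genusZeroOverCompleteDVR hF102 hθ) (hS6 k O θ hθ P q Y Ch hChStep hChSplit hYsp hYirr hYcl hPint hPnoeth hPreg hqprop hqsm
          (rationalCarrierLift_of_genusZeroOverCompleteDVR hF102 hθ))
        -- S7′ DISCHARGED: res-type-100's `inv_baseKCL` (…NatTCPlusInvBaseKCL p576847) at the `ConeForm` seed, in characteristic `p` of `k`
        (fun W _ hnot _ hcone => by
          haveI : Fact p.Prime := ⟨hp⟩
          haveI := hqprop; haveI := hX'int; haveI := hX'noeth; haveI := hF₁; haveI := hX₁int; haveI := hX₁noeth; haveI := hF₂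
          exact inv_baseKCL p k O θ hθ P q Y Ch hChSplit hPnoeth hPreg X' σ' S' hCh' hX'reg F₁ j t hsq T₁ x hx U hU s hs hsU hsx hdim hsoff X₁ τ₁
            hτ₁ hX₁reg hX₁dom F₂ υ hυ j₂ t₂ hsq₂ hcomm hcarrier hCh₁ hirr₂ W hnot hcone))
    hres

end Summit.ResolutionOfSingularities.ResolutionOfSingularities.Cruxes.EquisingularLiftNat.Sections

end
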